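import Summits.CriticalPhenomena.CardyFormulaZ2.Theorems.CardyIKTransportIKLinearTransportSDEPlumb4
import Summits.CriticalPhenomena.CardyFormulaZ2.Theorems.CardyIKTransportIKLinearTransportSDECore9
import Summits.CriticalPhenomena.CardyFormulaZ2.Theorems.CardyIKTransportIKLinearTransportStubStripDiagramExchangePart1

/-!
# Stub `stub_StripDiagramExchange` — THE STUB (plumbing part 5 and assembly)

Continues `…SDEPlumb4` and `…SDECore9`. Measurability of the coded observables, of the strip diagram as a function of the
observables (window diagrams are determined by finitely many cells and faces; countable union), and of the off-data
map; then THE ASSEMBLY: for a column pattern `S₀` agreeing with `S` off `{i, i+1}`, the law of (erased observables, strip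
diagram) under `νmix S₀` is the push-forward of `PJ ⊗ PJ` under `p ↦ (EE i S p.1 (ξ, ζ), diagram)` where `(ξ, ζ, diagram)`
is the coded output of the explicit strip model of type `[i ∈ S₀]` read off the core bits of `p.2` (re-anchoring, coding,
gluing, the two factorisations); by Fubini and THE CORE IDENTITY `SDE.core_map_eq` the inner law does not depend on the
type order, whence `StripDiagramExchange S i` for `S` and `S ∆ {i, i+1}`: the registered stub `stub_StripDiagramExchange`.
-/

set_option autoImplicit false

noncomputable section

namespace Summit.CriticalPhenomena.CardyFormulaZ2.Theorems.IKLinearTransport.PinnedDiagramExchange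

open scoped Classical MeasureTheory ENNReal ProbabilityTheory BigOperators
open MeasureTheory Literature.Probability.Percolation Literature.Probability.LatticeModels

namespace SDE
open scoped symmDiff

/-! ## §8 Measurability -/

/-- Bit tests are measurable. [folklore] -/
theorem meas_bitProp {α : Type*} [MeasurableSpace α] {f : α → Bool} (hf : Measurable f) (φ : Bool → Bool) :
    Measurable fun a => (φ (f a) = true : Prop) :=
  (measurable_of_countable fun t : Bool => (φ t = true : Prop)).comp hf

/-- Bit tests are measurable (plain form). [folklore] -/
theorem meas_eqTrue {α : Type*} [MeasurableSpace α] {f : α → Bool} (hf : Measurable f) :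
    Measurable fun a => (f a = true : Prop) :=
  (measurable_of_countable fun t : Bool => (t = true : Prop)).comp hf

/-- `Xor` of measurable predicates. [folklore] -/
theorem meas_xor {α : Type*} [MeasurableSpace α] {p q : α → Prop} (hp : Measurable p) (hq : Measurable q) :
    Measurable fun a => Xor (p a) (q a) :=
  (hp.and hq.not).or (hq.and hp.not)

/-- The plaquette parity read by the model is a measurable bit. [folklore] -/
theorem measurable_parJ (S : Set ℤ) (f : Site 2) : Measurable fun b : KJ => parJ S b f := by
  have h2 : Measurable fun b : KJ => (b (Sum.inr (Sum.inr (Sum.inl f))), b (Sum.inr (Sum.inr (Sum.inr (Sum.inl f))))) :=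
    (measurable_pi_apply _).prodMk (measurable_pi_apply _)
  exact (measurable_of_countable fun tt : Bool × Bool =>
    (decide (f 0 ∈ S) && tt.1) || (!decide (f 0 ∈ S) && tt.2)).comp h2

/-- The coded observables are measurable. [folklore] -/
theorem measurable_ObsJ (i : ℤ) (S : Set ℤ) : Measurable (ObsJ i S) := by
  refine (measurable_set_iff.2 fun v => ?_).prodMk (measurable_set_iff.2 fun f => ?_)
  · simp only [Set.mem_setOf_eq]
    refine meas_xor (meas_eqTrue (measurable_pi_apply _)) (meas_xor (meas_eqTrue (measurable_pi_apply _)) ?_)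
    have hm := measurable_odd_card_filter (fun (g : ℤ × ℤ) => meas_eqTrue (measurable_parJ S ![g.1, g.2]))
      (Finset.Ico (min i (v 0)) (max i (v 0)) ×ˢ Finset.Ico (min 0 (v 1)) (max 0 (v 1)))
    convert hm using 7
  · simp only [Set.mem_setOf_eq]
    exact measurable_const.or (meas_eqTrue (measurable_pi_apply _))

/-- Window diagrams of observables only read the window (general form). [folklore] -/
theorem DgW_congr_obs (i lo hi : ℤ) {x x' : Obs}
    (h1 : ∀ v : Site 2, i ≤ v 0 → v 0 ≤ i + 2 → lo ≤ v 1 → v 1 ≤ hi → (v ∈ x.1 ↔ v ∈ x'.1))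
    (h2 : ∀ f : Site 2, (f 0 = i ∨ f 0 = i + 1) → lo ≤ f 1 → f 1 < hi → (f ∈ x.2 ↔ f ∈ x'.2)) :
    DgW i lo hi x ⊆ DgW i lo hi x' := by
  rintro ⟨p, q⟩ ⟨hp, hq, ⟨⟨hqc, hq0, hq0'⟩, hq1, hq1'⟩, ⟨⟨-, hp0, hp0'⟩, hp1, hp1'⟩, hr⟩
  have hpc : p ∈ x.1 ↔ p ∈ x'.1 := h1 p hp0 hp0' hp1 hp1'
  have hset : clsW x i lo hi p ⊆ clsW x' i lo hi p := fun v ⟨⟨hv, hv0, hv0'⟩, hv1, hv1'⟩ =>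
    ⟨⟨by rw [← h1 v hv0 hv0' hv1 hv1', ← hpc]; exact hv, hv0, hv0'⟩, hv1, hv1'⟩
  refine ⟨hp, hq, ⟨⟨by rw [← h1 q hq0 hq0' hq1 hq1', ← hpc]; exact hqc, hq0, hq0'⟩, hq1, hq1'⟩,
    ⟨⟨Iff.rfl, hp0, hp0'⟩, hp1, hp1'⟩, within_mono _ hset (within_mono_graph _ (fun u v hu hv huv => ?_) hr)⟩
  rw [cellGraph_adj_iff] at huv ⊢
  refine (grid_adj_map _ _ 0 0 (u 0, u 1) (v 0, v 1) (fun c d hc hd => ?_)).1 huv |> fun e => by simpa using e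
  simp only at hc hd
  rw [add_zero, add_zero]
  have := hu.1.2.1; have := hu.1.2.2; have := hv.1.2.1; have := hv.1.2.2
  have := hu.2.1; have := hu.2.2; have := hv.2.1; have := hv.2.2
  exact h2 _ (by simp; omega) (by simp; omega) (by simp; omega)

/-- Window-diagram events of observables are measurable. [folklore] -/
theorem measurableSet_DgW_obs (i lo hi : ℤ) (pq : Site 2 × Site 2) : MeasurableSet {x : Obs | pq ∈ DgW i lo hi x} := by
  let C : Set (Site 2) := {v | i ≤ v 0 ∧ v 0 ≤ i + 2 ∧ lo ≤ v 1 ∧ v 1 ≤ hi}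
  let Fc : Set (Site 2) := {f | (f 0 = i ∨ f 0 = i + 1) ∧ lo ≤ f 1 ∧ f 1 < hi}
  have hbox : ∀ (D : Set (Site 2)) (a b c d : ℤ), (∀ v ∈ D, a ≤ v 0 ∧ v 0 ≤ b ∧ c ≤ v 1 ∧ v 1 ≤ d) → D.Finite := by
    intro D a b c d hD
    refine (((Set.finite_Icc a b).prod (Set.finite_Icc c d)).image fun ab : ℤ × ℤ => (![ab.1, ab.2] : Site 2)).subset ?_
    intro v hv
    obtain ⟨h1, h2, h3, h4⟩ := hD v hv
    exact ⟨(v 0, v 1), ⟨⟨h1, h2⟩, h3, h4⟩, site2_eta v⟩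
  have hC : C.Finite := hbox C i (i + 2) lo hi fun v hv => hv
  have hF : Fc.Finite := hbox Fc i (i + 1) lo hi fun v hv => ⟨by rcases hv.1 with e | e <;> omega, by rcases hv.1 with e | e <;> omega,
    hv.2.1, by have := hv.2.2; omega⟩
  haveI : Finite ↥C := hC.to_subtype
  haveI : Finite ↥Fc := hF.to_subtype
  have hρ : Measurable (fun x : Obs => ((fun v : ↥C => (v : Site 2) ∈ x.1), (fun f : ↥Fc => (f : Site 2) ∈ x.2))) :=
    (measurable_pi_lambda (fun (x : Obs) (v : ↥C) => (v : Site 2) ∈ x.1)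
      fun v => (measurable_set_mem (v : Site 2)).comp measurable_fst).prodMk
      (measurable_pi_lambda (fun (x : Obs) (f : ↥Fc) => (f : Site 2) ∈ x.2)
        fun f => (measurable_set_mem (f : Site 2)).comp measurable_snd)
  have hE : {x : Obs | pq ∈ DgW i lo hi x} = (fun x : Obs => ((fun v : ↥C => (v : Site 2) ∈ x.1), (fun f : ↥Fc => (f : Site 2) ∈ x.2))) ⁻¹'
      ((fun x : Obs => ((fun v : ↥C => (v : Site 2) ∈ x.1), (fun f : ↥Fc => (f : Site 2) ∈ x.2))) '' {x : Obs | pq ∈ DgW i lo hi x}) := by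
    ext x
    constructor
    · intro hx; exact ⟨x, hx, rfl⟩
    · rintro ⟨x', hx', he⟩
      have h1 : ∀ v : Site 2, i ≤ v 0 → v 0 ≤ i + 2 → lo ≤ v 1 → v 1 ≤ hi → (v ∈ x'.1 ↔ v ∈ x.1) := fun v a b c d => by
        have := congrFun (Prod.ext_iff.1 he).1 ⟨v, a, b, c, d⟩; exact Iff.of_eq this
      have h2 : ∀ f : Site 2, (f 0 = i ∨ f 0 = i + 1) → lo ≤ f 1 → f 1 < hi → (f ∈ x'.2 ↔ f ∈ x.2) := fun f a b c => by
        have := congrFun (Prod.ext_iff.1 he).2 ⟨f, a, b, c⟩; exact Iff.of_eq this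
      exact DgW_congr_obs i lo hi h1 h2 hx'
  rw [hE]
  exact (Set.toFinite _).measurableSet.preimage hρ

/-- THE STRIP DIAGRAM IS A MEASURABLE FUNCTION OF THE OBSERVABLES. [folklore] -/
theorem measurable_stripDiagram (i : ℤ) : Measurable (stripDiagram i : Obs → Set (Site 2 × Site 2)) := by
  refine measurable_set_iff.2 fun pq => measurableSet_setOf.1 ?_
  have e : {x : Obs | pq ∈ stripDiagram i x} = ⋃ m : ℕ, {x | pq ∈ DgW i (-m) m x} := by
    ext x; simp only [Set.mem_setOf_eq, Set.mem_iUnion]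
    exact ⟨fun h => exists_DgW i _ h, fun ⟨m, hm⟩ => DgW_subset _ _ _ _ hm⟩
  rw [e]
  exact MeasurableSet.iUnion fun m => measurableSet_DgW_obs i _ _ pq

/-- The off-data map is measurable in the boundary colourings. [folklore] -/
theorem measurable_EE (i : ℤ) (S : Set ℤ) (b₁ : KJ) : Measurable (EE i S b₁) := by
  refine (measurable_set_iff.2 fun v => ?_).prodMk measurable_const
  simp only [Set.mem_setOf_eq]
  have m1 : Measurable fun ξζ : (ℤ → Bool) × (ℤ → Bool) => ξζ.1 (v 1) := (measurable_pi_apply _).comp measurable_fst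
  have m2 : Measurable fun ξζ : (ℤ → Bool) × (ℤ → Bool) => ξζ.2 (v 1) := (measurable_pi_apply _).comp measurable_snd
  exact measurable_const.and ((measurable_const.and (meas_xor measurable_const
    (meas_xor (meas_bitProp m1 fun t => t ^^ b₁ (Sum.inl i)) measurable_const))).or
    ((measurable_const.and (meas_eqTrue m1)).or ((measurable_const.and (meas_eqTrue m2)).or
      (measurable_const.and (meas_xor measurable_const
        (meas_xor (meas_bitProp m2 fun t => t ^^ b₁ (Sum.inl (i + 2))) measurable_const))))))

/-! ## §9 The final assembly -/

/-- Decoding the coded output. [folklore] -/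
def Dec (t : Cidx → Bool) : ((ℤ → Bool) × (ℤ → Bool)) × Set (Site 2 × Site 2) :=
  ((fun y => t (Sum.inl y), fun y => t (Sum.inr (Sum.inl y))), {pq | t (Sum.inr (Sum.inr pq)) = true})

/-- `Dec` is measurable. [folklore] -/
theorem measurable_Dec : Measurable Dec :=
  ((measurable_pi_lambda _ fun _ => measurable_pi_apply _).prodMk (measurable_pi_lambda _ fun _ => measurable_pi_apply _)).prodMk
    (measurable_set_iff.2 fun _ => meas_eqTrue (measurable_pi_apply _))

/-- `Dec` decodes. [folklore] -/
theorem Dec_Outπ (i : ℤ) (τ κ₀ κ₂ : Bool) (c : K) :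
    Dec (Outπ i τ κ₀ κ₂ c) = (bdry κ₀ κ₂ c, stripDiagram i (X i τ κ₀ κ₂ c)) := by
  refine Prod.ext (Prod.ext rfl rfl) (Set.ext fun pq => ?_)
  simp [Dec, Outπ]

/-- The inner map of the assembly. [folklore] -/
def GG (i : ℤ) (S : Set ℤ) (b₁ : KJ) (t : Cidx → Bool) : Obs × Set (Site 2 × Site 2) := (EE i S b₁ (Dec t).1, (Dec t).2)

/-- The assembled map on pairs of samples. [folklore] -/
def FF (i : ℤ) (S : Set ℤ) (τ : Bool) (p : KJ × KJ) : Obs × Set (Site 2 × Site 2) :=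
  GG i S p.1 (Outπ i τ (p.1 (Sum.inl i)) (p.1 (Sum.inl (i + 2))) (coreOf i τ p.2))

/-- `GG` is measurable. [folklore] -/
theorem measurable_GG (i : ℤ) (S : Set ℤ) (b₁ : KJ) : Measurable (GG i S b₁) :=
  ((measurable_EE i S b₁).comp (measurable_Dec.fst)).prodMk measurable_Dec.snd

/-- The gluing lemma for `PJ`. [folklore] -/
theorem PJ_glue (i : ℤ) : (PJ.prod PJ).map (fun p => glue (Amid i) p.1 p.2) = PJ ∧
    Measurable (fun p : KJ × KJ => glue (Amid i) p.1 p.2) := by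
  constructor
  · unfold PJ; exact infinitePi_glue _ _
  · refine measurable_pi_lambda _ fun j => ?_
    by_cases hj : j ∈ Amid i
    · simp only [glue, hj, if_true]; fun_prop
    · simp only [glue, hj, if_false]; fun_prop

/-- THE KEY REWRITING: for a column pattern `S₀` agreeing with `S` off `{i, i+1}`, the law of (erased observables,
strip diagram) under `νmix S₀` is the push-forward of `PJ ⊗ PJ` under the assembled map of type `τ = [i ∈ S₀]`. [folklore] -/
theorem key_rewrite (S : Set ℤ) (i : ℤ) (S₀ : Set ℤ) (τ : Bool) (hτ : decide (i ∈ S₀) = τ) (h₀ : i ∈ S₀ ↔ i + 1 ∉ S₀)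
    (hS : ∀ x : ℤ, x ≠ i → x ≠ i + 1 → (x ∈ S₀ ↔ x ∈ S)) :
    Measurable (FF i S τ) ∧
      (νmix S₀).map (fun x => (eraseMid i x, stripDiagram i x)) = (PJ.prod PJ).map (FF i S τ) := by
  obtain ⟨hglue, hgm⟩ := PJ_glue i
  have hT : Measurable (fun x : Obs => (eraseMid i x, stripDiagram i x)) := (measurable_eraseMid i).prodMk (measurable_stripDiagram i)
  have hfun : (fun p : KJ × KJ => (eraseMid i (ObsJ i S₀ (glue (Amid i) p.1 p.2)), stripDiagram i (ObsJ i S₀ (glue (Amid i) p.1 p.2)))) =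
      FF i S τ := by
    funext p
    obtain ⟨hx, -, hf⟩ := glue_off i p.1 p.2
    refine Prod.ext ?_ ?_
    · show eraseMid i (ObsJ i S₀ (glue (Amid i) p.1 p.2)) = EE i S p.1 (Dec (Outπ i τ (p.1 (Sum.inl i)) (p.1 (Sum.inl (i + 2))) (coreOf i τ p.2))).1
      rw [eraseMid_ObsJ_off i S₀ h₀ τ hτ p.1 _ hx hf, EE_congr i hS, Dec_Outπ, (X_coreOf_glue i τ _ _ p.1 p.2).2]
    · show stripDiagram i (ObsJ i S₀ (glue (Amid i) p.1 p.2)) = (Dec (Outπ i τ (p.1 (Sum.inl i)) (p.1 (Sum.inl (i + 2))) (coreOf i τ p.2))).2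
      rw [stripDiagram_ObsJ i S₀ h₀, hτ, hx i (by omega), hx (i + 2) (by omega), (X_coreOf_glue i τ _ _ p.1 p.2).1, Dec_Outπ]
  have hFm : Measurable (FF i S τ) := hfun ▸ hT.comp ((measurable_ObsJ i S₀).comp hgm)
  refine ⟨hFm, ?_⟩
  rw [nuMix_eq_map_ObsJ S₀ i (measurable_ObsJ i S₀), Measure.map_map hT (measurable_ObsJ i S₀)]
  conv_lhs => rw [← hglue]
  rw [Measure.map_map (hT.comp (measurable_ObsJ i S₀)) hgm, ← hfun]
  rfl

/-- THE STUB: `StripDiagramExchange S i` from the finite pinned identity on all cylinders. [folklore] -/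
theorem strip_main (hDX : ∀ (L : ℕ) [NeZero L], 3 ≤ L → DiagramExchangeAt L) (S : Set ℤ) (i : ℤ) (h : i ∈ S ↔ i + 1 ∉ S) :
    StripDiagramExchange S i := by
  set τ := decide (i ∈ S) with hτdef
  obtain ⟨hF1, e1⟩ := key_rewrite S i S τ rfl h (fun _ _ _ => Iff.rfl)
  obtain ⟨hF2, e2⟩ := key_rewrite S i (symmDiff S {i, i + 1}) (!τ)
    (by by_cases hi : i ∈ S <;> simp [Set.mem_symmDiff, hi, hτdef])
    (by simp only [Set.mem_symmDiff, Set.mem_insert_iff, Set.mem_singleton_iff]; constructor <;> intro h1 <;> [skip; skip] <;> tauto)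
    (fun x h1 h2 => by simp [Set.mem_symmDiff, h1, h2])
  rw [StripDiagramExchange, e1, e2]
  refine Measure.ext fun B hB => ?_
  rw [Measure.map_apply hF1 hB, Measure.map_apply hF2 hB, Measure.prod_apply (hF1 hB), Measure.prod_apply (hF2 hB)]
  refine lintegral_congr fun b₁ => ?_
  have inner : ∀ τ' : Bool, PJ (Prod.mk b₁ ⁻¹' (FF i S τ' ⁻¹' B)) =
      ((P.map (Outπ i τ' (b₁ (Sum.inl i)) (b₁ (Sum.inl (i + 2))))).map (GG i S b₁)) B := by
    intro τ'
    rw [Measure.map_apply (measurable_GG i S b₁) hB, Measure.map_apply (measurable_Outπ i τ' _ _) (measurable_GG i S b₁ hB),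
      ← map_coreOf i τ', Measure.map_apply (measurable_coreOf i τ') (measurable_Outπ i τ' _ _ (measurable_GG i S b₁ hB))]
    rfl
  rw [inner, inner]
  have hcore : ∀ τ' : Bool, P.map (Outπ i τ' (b₁ (Sum.inl i)) (b₁ (Sum.inl (i + 2)))) = P.map (Outπ i true (b₁ (Sum.inl i)) (b₁ (Sum.inl (i + 2)))) := by
    intro τ'; cases τ'
    · exact (core_map_eq hDX i _ _).symm
    · rfl
  rw [hcore τ, hcore (!τ)]


end SDE

/-- STUB `stub_StripDiagramExchange` (line `pinned-diagram-exchange`, crux stmt-CriticalPhenomena-5076) · strip diagram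
exchange ("`DiagramExchangeAt ∞`"): from the finite pinned identity on every cylinder `ℤ/L`, the joint law of (off-column
observables, strip diagram) is the same for `S` and `S ∆ {i, i+1}`. [folklore] -/
theorem stub_StripDiagramExchange :
    (∀ (L : ℕ) [NeZero L], 3 ≤ L → DiagramExchangeAt L) →
      ∀ (S : Set ℤ) (i : ℤ), (i ∈ S ↔ i + 1 ∉ S) → StripDiagramExchange S i := by
  intro hDX S i h
  exact SDE.strip_main hDX S i h

end Summit.CriticalPhenomena.CardyFormulaZ2.Theorems.IKLinearTransport.PinnedDiagramExchange
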